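import Mathlib.LinearAlgebra.Matrix.PosDef
import Mathlib.LinearAlgebra.Matrix.SchurComplement
import Mathlib.Analysis.Matrix.Order
import Literature.NumberTheory.Automorphic.SiegelReducedFamilies
import Literature.NumberTheory.Automorphic.AdelicGLnGlue
import HarnessLib

/-!
# Reduced Siegel families are positive definite (stub `stub_hull_posDef` of line `Sketch`)

Crux `HeckeEigenvalueField` (stmt-Langlands-13632).  The Čech-nerve proof of the Borel–Serre
finite-dimensionality theorem for congruence subgroups of `GL_n` over a number field `K` works on
the cone `X` of matrices `H` over `mixedSpace K = ℝ^{r₁} × ℂ^{r₂}` which are positive definite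
place by place (`(H.map (mixedSpaceEvalReal K w)).PosDef` at the real places,
`(H.map (mixedSpaceEvalComplex K w)).PosDef` at the complex places), covered by translates of
convex hulls of Siegel domains.  Siegel domains are described recursively by the predicate
`SiegelFamily.IsReduced c C τ m H` on families `H : ι → Matrix (Fin m) (Fin m) ℂ`
(`Literature/NumberTheory/Automorphic/SiegelReducedFamilies`): every `H w` is Hermitian, the last
pivot `H w m m` has positive real part, and the family of Schur complements
`SiegelFamily.schur H` is reduced.

This file proves the registered stub `stub_hull_posDef`:

1. a reduced family consists of positive definite matrices — induction on `m`, the inductive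
   step being the Schur-complement criterion: after reindexing `Fin (m + 1) ≃ Fin m ⊕ Fin 1`
   the matrix `H w` is the block matrix `[A B; Bᴴ D]` with `D = (H w m m)` positive definite
   (`1 × 1`, positive real entry) and Schur complement `A - B D⁻¹ Bᴴ = schur H w` positive
   definite by induction, so `H w` is positive semidefinite (Mathlib
   `Matrix.PosDef.fromBlocks₂₂`) with non-zero determinant `det D · det (schur H w)`
   (`Matrix.det_fromBlocks₂₂`), hence positive definite
   (`Matrix.PosSemidef.posDef_iff_det_ne_zero`);
2. for a matrix `H` over `mixedSpace K` whose family of places `SiegelFamily.placeFamily K H` is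
   reduced, the cone condition holds in its native form: at a complex place the member of the
   family IS `H.map (mixedSpaceEvalComplex K w)`, at a real place it is the real matrix
   `H.map (mixedSpaceEvalReal K w)` read in `ℂ`, and a real matrix which is positive definite as
   a complex matrix is positive definite (its quadratic form on real vectors is the complex one).

## References

* A. Borel, *Introduction aux groupes arithmétiques*, Hermann (1969), §1, §12–§13 [Borel1969]
  (Siegel sets on the cone of positive forms).
-/

noncomputable section

set_option linter.dupNamespace false -- project-wide: `Summit.Langlands.Langlands` is the mandated namespace

open scoped ComplexOrder Matrix
open NumberField NumberField.mixedEmbedding Literature.NumberTheory.Automorphic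

namespace Summit.Langlands.Langlands.Theorems.HeckeEigenvalueField.Res

/-! ### Positive definiteness: the empty matrix and the Schur-complement step -/

/-- The `0 × 0` complex matrix is positive definite (there is no non-zero vector). [folklore] -/
theorem posDef_fin_zero (M : Matrix (Fin 0) (Fin 0) ℂ) : M.PosDef :=
  Matrix.PosDef.of_dotProduct_mulVec_pos (Matrix.IsHermitian.ext fun i => Fin.elim0 i)
    fun x hx => absurd (Subsingleton.elim x 0) hx

/-- **Schur-complement criterion (peeling the last index)**: a Hermitian `(m+1) × (m+1)` complex
matrix whose last diagonal entry has positive real part and whose Schur complement of that entry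
(`SiegelFamily.schur`) is positive definite is positive definite. [folklore] -/
theorem posDef_of_schur_posDef {ι : Type*} {m : ℕ}
    (H : ι → Matrix (Fin (m + 1)) (Fin (m + 1)) ℂ) (w : ι) (hH : (H w).IsHermitian)
    (ha : 0 < (H w (Fin.last m) (Fin.last m)).re) (hS : (SiegelFamily.schur H w).PosDef) :
    (H w).PosDef := by
  classical
  -- the last pivot is a positive real number
  have ha_im : (H w (Fin.last m) (Fin.last m)).im = 0 :=
    Complex.conj_eq_iff_im.mp (hH.apply (Fin.last m) (Fin.last m))
  have ha_pos : (0 : ℂ) < H w (Fin.last m) (Fin.last m) := Complex.pos_iff.mpr ⟨ha, ha_im.symm⟩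
  -- the blocks of `H w` after reindexing `Fin (m + 1) ≃ Fin m ⊕ Fin 1`
  set A : Matrix (Fin m) (Fin m) ℂ := Matrix.of fun i j => H w i.castSucc j.castSucc with hA_def
  set B : Matrix (Fin m) (Fin 1) ℂ := Matrix.of fun i _ => H w i.castSucc (Fin.last m) with hB_def
  set D : Matrix (Fin 1) (Fin 1) ℂ := Matrix.diagonal fun _ => H w (Fin.last m) (Fin.last m)
    with hD_def
  have hD : D.PosDef := Matrix.PosDef.diagonal fun _ => ha_pos
  have hDdet : D.det = H w (Fin.last m) (Fin.last m) := by
    simp [hD_def]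
  letI : Invertible D :=
    D.invertibleOfIsUnitDet (by rw [hDdet]; exact isUnit_iff_ne_zero.mpr ha_pos.ne')
  have hDinv : D⁻¹ = Matrix.diagonal fun _ : Fin 1 => (H w (Fin.last m) (Fin.last m))⁻¹ := by
    rw [Matrix.inv_subsingleton]
    refine congrArg Matrix.diagonal (funext fun i => ?_)
    rw [hD_def, Matrix.diagonal_apply_eq, Ring.inverse_eq_inv]
  -- the Schur complement of the block decomposition is `SiegelFamily.schur H w`
  have hschur : A - B * D⁻¹ * Bᴴ = SiegelFamily.schur H w := by
    rw [hDinv]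
    ext i j
    simp only [hA_def, hB_def, Matrix.sub_apply, Matrix.mul_apply, Matrix.of_apply,
      Matrix.conjTranspose_apply, Matrix.diagonal_apply_eq, Finset.univ_unique,
      Finset.sum_singleton, SiegelFamily.schur_apply]
    rw [hH.apply (Fin.last m) j.castSucc]
    ring
  -- the block decomposition itself
  have hblocks : (H w).submatrix (finSumFinEquiv (m := m) (n := 1)) finSumFinEquiv =
      Matrix.fromBlocks A B Bᴴ D := by
    ext (i | i) (j | j)
    · rfl
    · obtain rfl : j = 0 := Subsingleton.elim _ _
      rfl
    · obtain rfl : i = 0 := Subsingleton.elim _ _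
      exact (hH.apply _ _).symm
    · obtain rfl : i = 0 := Subsingleton.elim _ _
      obtain rfl : j = 0 := Subsingleton.elim _ _
      simp only [Matrix.submatrix_apply, Matrix.fromBlocks_apply₂₂, hD_def, Matrix.diagonal_apply_eq]
      rfl
  -- positive semidefinite with non-zero determinant
  have hPSD : (Matrix.fromBlocks A B Bᴴ D).PosSemidef := by
    rw [Matrix.PosDef.fromBlocks₂₂ A B hD, hschur]
    exact hS.posSemidef
  have hdet : (Matrix.fromBlocks A B Bᴴ D).det ≠ 0 := by
    rw [Matrix.det_fromBlocks₂₂, Matrix.invOf_eq_nonsing_inv, hschur, hDdet]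
    exact mul_ne_zero ha_pos.ne' (hS.posSemidef.posDef_iff_det_ne_zero.mp hS)
  have hM : ((H w).submatrix (finSumFinEquiv (m := m) (n := 1)) finSumFinEquiv).PosDef := by
    rw [hblocks]
    exact hPSD.posDef_iff_det_ne_zero.mpr hdet
  simpa [Matrix.submatrix_submatrix] using
    hM.submatrix (e := (finSumFinEquiv (m := m) (n := 1)).symm) (Equiv.injective _)

/-- **Reduced families are positive definite at every index** (so the prototype of the cover lies
in the cone of positive forms): induction on the size, peeling the last pivot. [folklore] -/
theorem posDef_of_isReduced {ι : Type*} (c C τ : ℝ) :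
    ∀ (m : ℕ) (H : ι → Matrix (Fin m) (Fin m) ℂ),
      SiegelFamily.IsReduced c C τ m H → ∀ w, (H w).PosDef
  | 0, H, _, w => posDef_fin_zero (H w)
  | m + 1, H, h, w =>
    posDef_of_schur_posDef H w (h.1 w) (h.2.1 w)
      (posDef_of_isReduced c C τ m (SiegelFamily.schur H) h.2.2.2.2.2 w)

/-! ### Real matrices positive definite over `ℂ` -/

/-- A real matrix which is positive definite as a complex matrix is positive definite: it is
symmetric (conjugation fixes real entries) and its quadratic form at a real vector is the complex
quadratic form at that vector. [folklore] -/
theorem posDef_of_map_ofReal {k : Type*} [Fintype k] {A : Matrix k k ℝ}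
    (hA : (A.map ((↑) : ℝ → ℂ)).PosDef) : A.PosDef := by
  refine Matrix.PosDef.of_dotProduct_mulVec_pos ?_ fun x hx => ?_
  · refine Matrix.IsHermitian.ext fun i j => ?_
    have h := hA.1.apply i j
    simp only [Matrix.map_apply, Complex.star_def, Complex.conj_ofReal, Complex.ofReal_inj] at h
    simpa using h
  · have hx' : (fun i => (x i : ℂ)) ≠ 0 := by
      intro h0
      apply hx
      funext i
      have hi := congr_fun h0 i
      simpa using hi
    have hpos := hA.dotProduct_mulVec_pos hx'
    have hcast : star (fun i => (x i : ℂ)) ⬝ᵥ (A.map ((↑) : ℝ → ℂ) *ᵥ fun i => (x i : ℂ)) =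
        ((star x ⬝ᵥ (A *ᵥ x) : ℝ) : ℂ) := by
      simp [dotProduct, Matrix.mulVec, Complex.ofReal_sum, Complex.ofReal_mul]
    rw [hcast, Complex.zero_lt_real] at hpos
    exact hpos

/-! ### Matrices over `mixedSpace K` with reduced family of places -/

/-- **Cone membership of matrices over `K ⊗ ℝ` with reduced family of places**: if
`SiegelFamily.placeFamily K H` is reduced then `H` is positive definite at every real place (as
a real matrix) and at every complex place. [folklore] -/
theorem posDef_eval_of_isReduced_placeFamily (n : ℕ) (K : Type) [Field K] [NumberField K]
    (c C τ : ℝ) (H : Matrix (Fin n) (Fin n) (mixedSpace K))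
    (h : SiegelFamily.IsReduced c C τ n (SiegelFamily.placeFamily K H)) :
    (∀ w, (H.map (mixedSpaceEvalReal K w)).PosDef) ∧
      ∀ w, (H.map (mixedSpaceEvalComplex K w)).PosDef := by
  have hw := posDef_of_isReduced c C τ n _ h
  refine ⟨fun w => ?_, fun w => ?_⟩
  · have e : (H.map (mixedSpaceEvalReal K w)).map ((↑) : ℝ → ℂ) =
        SiegelFamily.placeFamily K H w.1 := by
      rw [SiegelFamily.placeFamily_apply_of_isReal H w.2, Matrix.map_map]
      rfl
    have h1 := hw w.1
    rw [← e] at h1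
    exact posDef_of_map_ofReal h1
  · have e : H.map (mixedSpaceEvalComplex K w) = SiegelFamily.placeFamily K H w.1 := by
      rw [SiegelFamily.placeFamily_apply_of_isComplex H w.2]
      rfl
    have h1 := hw w.1
    rw [← e] at h1
    exact h1

/-! ### The registered stub -/

/-- **Stub `stub_hull_posDef` of line `Sketch`** (crux `HeckeEigenvalueField`,
stmt-Langlands-13632): (1) a `(c, C, τ)`-reduced family of complex matrices is positive definite
at every index; (2) a matrix over `mixedSpace K` whose family of places is reduced lies in the
cone of positive forms (real positive definite at the real places, complex positive definite at
the complex places). [folklore] -/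
theorem stub_hull_posDef :
    (∀ (ι : Type) (m : ℕ) (c C τ : ℝ) (H : ι → Matrix (Fin m) (Fin m) ℂ),
      SiegelFamily.IsReduced c C τ m H → ∀ w, (H w).PosDef) ∧
    (∀ (n : ℕ) (K : Type) [Field K] [NumberField K] (c C τ : ℝ)
      (H : Matrix (Fin n) (Fin n) (mixedSpace K)),
      SiegelFamily.IsReduced c C τ n (SiegelFamily.placeFamily K H) →
        (∀ w, (H.map (mixedSpaceEvalReal K w)).PosDef) ∧
          ∀ w, (H.map (mixedSpaceEvalComplex K w)).PosDef) :=
  ⟨fun _ m c C τ H h => posDef_of_isReduced c C τ m H h,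
    fun n K _ _ c C τ H h => posDef_eval_of_isReduced_placeFamily n K c C τ H h⟩

end Summit.Langlands.Langlands.Theorems.HeckeEigenvalueField.Res
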